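import Summits.BirchSwinnertonDyer.BirchSwinnertonDyer.Theses.GenusKolyvaginAtTwo
import Literature.NumberTheory.EllipticCurves.HeegnerPointsOfConductorOneData
import HarnessLib

/-!
# Route `GenusKolyvaginAtTwo`, crux stmt-BirchSwinnertonDyer-24947 `MultiGenusPrimitivityAtTwo` (U, the open kernel of the
# rev-7 split of crux 22136), registered stub `stub_levelOne` of the pen's birth skeleton `U_birth.lean` (2026-08-28T03:32Z)

Lead prover seat bsd-line-gk2-p1 (g4). The birth skeleton of U splits on the 2-divisibility exponent `M₀` of the Heegner point
`y_K = P(1)` in `E(K[1])`: `stub_levelOne` is the case `M₀ = 0` (`P(1) ∉ 2E(K[1])`), `stub_positiveDepth` the case `M₀ ≥ 1`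
(the open kernel). At level `n = 1` the multi-genus trace of U degenerates to the Heegner point itself: there are no Kolyvagin
primes, no genus square roots, the stabiliser `T` is all of `𝒢_1 = Gal(K[1]/K)`, and `Z_1 = Σ_{g ∈ 𝒢_1} g·y(1) = Tr_{K[1]/K} y(1)
= P(1)` (Gross 1991, §4: "note that `P_1 = Σ_{σ ∈ S} σ y_1 = Tr_{K_1/K}(y_1) = y_K`"). The two tree inputs are
`KolyvaginHeegnerData.derivedPoint_one` (`P(1) = Σ_{s ∈ S} s·y(1)`) and `KolyvaginHeegnerData.mem_S_iff` (at conductor `1` the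
transversal `S` is forced to be `𝒢_1`, because `G_1 = Gal(K[1]/K[1])` is trivial). So `M₀ = 0` IS the certificate at level `1`, with
witnesses `n := 1`, `d := d₁`, `T := d₁.S`. The statement proved is the registered signature of `stub_levelOne` VERBATIM.
No summit, no leaf and no crux is proved by this; U's open content is `stub_positiveDepth`. BSD is not proved by any of this.
-/

set_option linter.dupNamespace false -- tree convention: `Summit.BirchSwinnertonDyer.BirchSwinnertonDyer.Theorems` (D-0017)

namespace Summit.BirchSwinnertonDyer.BirchSwinnertonDyer.Theorems.MultiGenusPrimitivityAtTwo

open Summit.BirchSwinnertonDyer.BirchSwinnertonDyer.Theses.GenusKolyvaginAtTwo Literature.NumberTheory.EllipticCurves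

/-- **Level one: the multi-genus trace at `n = 1` is `P(1)`.** For a conductor-`1` datum `d₁`, the sum of the `𝒢_1`-conjugates of
`y(1)` over the (forced) transversal `d₁.S = 𝒢_1` is the derived point `P(1) = y_K` (Gross 1991, §4, remark after (4.1)).
[cite: GrossLMS1991, §4 (P_1 = Tr y_1 = y_K)] -/
theorem sum_S_pointGalHom_y_eq_derivedPoint {N : ℕ} [NeZero N] {W : WeierstrassCurve ℚ} {K : Type} [Field K] [NumberField K]
    {Dt : ModularForms.ModularParametrizationData W N} {β : ℤ} {ι : K →+* ℂ} (d₁ : KolyvaginHeegnerData Dt β ι 1) :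
    ∑ g ∈ d₁.S, pointGalHom W (ringClassField K ι 1) g d₁.y = d₁.derivedPoint :=
  d₁.derivedPoint_one.symm

/-- **At conductor `1` the genus stabiliser is all of `𝒢_1` and equals the datum's transversal**: `g ∈ d₁.S ↔ g ∈ 𝒢_1 ∧
(∀ ℓ ∣ 1 prime, g θ_ℓ = θ_ℓ)` — the second conjunct is vacuous (`1` has no prime factors) and the first is
`KolyvaginHeegnerData.mem_S_iff` (`G_1 = 1`). [cite: GrossLMS1991, §4 (P_1 = Tr y_1 = y_K)] -/
theorem mem_S_iff_mem_ringClassGal_and {N : ℕ} [NeZero N] {W : WeierstrassCurve ℚ} {K : Type} [Field K] [NumberField K]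
    {Dt : ModularForms.ModularParametrizationData W N} {β : ℤ} {ι : K →+* ℂ} (d₁ : KolyvaginHeegnerData Dt β ι 1)
    (θ : ℕ → ringClassField K ι 1) (g : ringClassField K ι 1 ≃ₐ[ℚ] ringClassField K ι 1) :
    g ∈ d₁.S ↔ g ∈ ringClassGal ι 1 ∧ ∀ ℓ ∈ (1 : ℕ).primeFactors, g (θ ℓ) = θ ℓ := by
  rw [d₁.mem_S_iff, Nat.primeFactors_one]
  simp only [Finset.notMem_empty, IsEmpty.forall_iff, implies_true, and_true]

/-- **Registered stub `stub_levelOne` of crux 24947 `MultiGenusPrimitivityAtTwo`** (pen's birth skeleton `U_birth.lean`, depth split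
at level one), signature VERBATIM: under U's hypotheses, if the Heegner point `P(1) = y_K` is NOT `2`-divisible in `E(K[1])`
(`M₀ = 0`), then U's conclusion holds with `n := 1`, `d := d₁`, `T := d₁.S = 𝒢_1` (and any `θ`): the level-`1` multi-genus trace is
`Z_1 = Tr_{K[1]/K} y(1) = P(1)` (Gross 1991, §4), so its `2`-indivisibility is the hypothesis. All of U's other binders (habitat,
Heegner field, optimality, twin) are idle here. [cite: GrossLMS1991, §4 (P_1 = Tr y_1 = y_K)] -/
theorem stub_levelOne : ∀ (W : WeierstrassCurve ℚ) [W.IsElliptic] [W.IsGloballyMinimal] [NeZero (W.conductorNorm ℤ)], ¬ W.HasCM → W.analyticRank = 0 → (∀ n : ℕ, 0 < n → W.HasSurjectiveModNGaloisRep ((2 : ℤ) ^ n)) → Odd W.tamagawaProduct → ∀ (K : Type) [Field K] [NumberField K], Literature.NumberTheory.EllipticCurves.IsImaginaryQuadratic K → Odd (NumberField.discr K) → NumberField.discr K ≠ -3 → Literature.NumberTheory.EllipticCurves.SatisfiesHeegnerHypothesis (W.conductorNorm ℤ) K → ¬ IsSquare ((NumberField.discr K : ℚ) * -|W.Δ|)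 → ¬ IsSquare ((NumberField.discr K : ℚ) * (-(2 * |W.Δ|))) → ∀ (Dt : Literature.NumberTheory.EllipticCurves.ModularForms.ModularParametrizationData W (W.conductorNorm ℤ)), (∀ z ∈ Dt.L.lattice, ∃ w ∈ Literature.NumberTheory.EllipticCurves.ModularForms.periodLattice Dt.f, z = (Dt.c : ℂ) * w) → Odd Dt.c → ∀ (β : ℤ) (ι : K →+* ℂ) (d₁ : Literature.NumberTheory.EllipticCurves.KolyvaginHeegnerData Dt β ι 1), ¬ IsOfFinAddOrder d₁.derivedPoint → ∀ (Wd : WeierstrassCurve ℚ) [Wd.IsElliptic] [Wd.IsGloballyMinimal], (∃ C : WeierstrassCurve.VariableChange ℚ, C • W.quadraticTwist (NumberField.discr K : ℚ) = Wd) → Wd.analyticRank = 1 → Nat.card (Wd.selmerGroup 2) = 2 → ¬ (∃ Q : (W.baseChange (Literature.NumberTheory.EllipticCurves.ringClassField K ι 1)).toAffine.Point, (2 : ℤ) • Q = d₁.derivedPoint) → ∃ (n : ℕ) (d : Literature.NumberTheory.EllipticCurves.KolyvaginHeegnerData Dt β ι n) (θ : ℕ → Literature.NumberTheory.EllipticCurves.ringClassField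 K ι n) (T : Finset (Literature.NumberTheory.EllipticCurves.ringClassField K ι n ≃ₐ[ℚ] Literature.NumberTheory.EllipticCurves.ringClassField K ι n)), Squarefree n ∧ (∀ ℓ ∈ n.primeFactors, Literature.NumberTheory.EllipticCurves.Zhang2014.IsKolyvaginPrime (W.conductorNorm ℤ) W K 2 ℓ) ∧ (∀ ℓ ∈ n.primeFactors, θ ℓ ^ 2 = algebraMap ℚ (Literature.NumberTheory.EllipticCurves.ringClassField K ι n) ((-1 : ℚ) ^ (ℓ / 2) * ℓ)) ∧ (∀ g, g ∈ T ↔ g ∈ Literature.NumberTheory.EllipticCurves.ringClassGal ι n ∧ ∀ ℓ ∈ n.primeFactors, g (θ ℓ) = θ ℓ) ∧ ¬ ∃ Q : (W.baseChange (Literature.NumberTheory.EllipticCurves.ringClassField K ι n)).toAffine.Point, (2 : ℤ) • Q = ∑ g ∈ T, Literature.NumberTheory.EllipticCurves.pointGalHom W (Literature.NumberTheory.EllipticCurves.ringClassField K ι n) g d.y := by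
  intro W _ _ _ _ _ _ _ K _ _ _ _ _ _ _ _ Dt _ _ β ι d₁ _ Wd _ _ _ _ _ hM₀
  refine ⟨1, d₁, fun _ ↦ 0, d₁.S, squarefree_one, ?_, ?_, mem_S_iff_mem_ringClassGal_and d₁ _, ?_⟩
  · simp only [Nat.primeFactors_one, Finset.notMem_empty, IsEmpty.forall_iff, implies_true]
  · simp only [Nat.primeFactors_one, Finset.notMem_empty, IsEmpty.forall_iff, implies_true]
  · rw [sum_S_pointGalHom_y_eq_derivedPoint]
    exact hM₀

end Summit.BirchSwinnertonDyer.BirchSwinnertonDyer.Theorems.MultiGenusPrimitivityAtTwo
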